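import Summits.ResolutionOfSingularities.ResolutionOfSingularities.Theorems.FrobeniusLadderFRationalResolutionEtaleChartTwoStepModelScheme
import Summits.ResolutionOfSingularities.ResolutionOfSingularities.Theorems.FrobeniusLadderFRationalResolutionFixedPointCompletionChartParameters
import Summits.ResolutionOfSingularities.ResolutionOfSingularities.Theorems.FrobeniusLadderFRationalResolutionMonomialAlgebraCompletion
import HarnessLib

/-!
# Crux `FrobeniusLadder.FRationalResolution` (stmt-ResolutionOfSingularities-15317), line `redirect`,
# stub `stub_diagonalizableQuotientResolution` — THE NAIVE TWO-STEP RECIPE AT FIXED POINTS OF QUOTIENT CHARTS, PACKAGED: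
# the model isomorphism `e : (T_𝔳)^ ≅ (𝒪_{Spec S₀, 𝔮})^` is PRODUCED (item (β-naive), «packaging of `e`», of
# MEMO-15317-leafhand2-g24 §3), so the only inputs left at such a point are facts about a toric MODEL `T`

`…EtaleChartTwoStepModelScheme.hloc_of_model_charts_etale_nhd` (p842996) resolves an isolated singular point `x = φ y` of `X`
from an étale neighbourhood `φ : Y → X`, a model `T` of finite type over a field `κ` with `e : (T_𝔳)^ ≃+* (𝒪_{Y,y})^`, the
off-vertex regularity of `Spec T` and the chart facts of the two-step recipe on `T[𝔳^{a+1}/xᵢ]`. At a `D(A)`-FIXED prime `𝔔`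
of a quotient chart `Spec S₀ → X` (the frame of the stub: `S` of finite type over a field, graded by a torsion group `A`,
`S₀ = 𝒮 0`) with homogeneous regular parameters `xᵢ ∈ 𝔔 ∩ S_{aᵢ}` the isomorphism `e` is AUTOMATIC for every model `T`
carrying a multiplicative chart by the weight kernel `P = {m : Σ mᵢ • aᵢ = 0}` at a `κ(𝔮)`-rational maximal ideal `𝔳` of
dimension `n`: `(T_𝔳)^ ≅ κ(𝔮)⟦P⟧` (`…MonomialAlgebraCompletion.exists_ringEquiv_monoidPowerSeries_adicCompletion_of_chart`,
p840652) and `κ(𝔮)⟦P⟧ ≅ ((S₀)_𝔮)^` (`…FixedPointCompletionChart.exists_ringEquiv_monoidPowerSeries_adicCompletion_of_parameters`,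
p840822), then `((S₀)_𝔮)^ ≅ (𝒪_{Spec S₀, 𝔮})^` along `Spec.stalkIso`.

* ★★★ `hloc_of_fixedPoint_two_step_chart` — `hloc` at `x = φ 𝔮` from: the fixed-point data, ANY model `(T, 𝔳, χ)` charted by
  `P` over `κ(𝔮)` (e.g. `κ(𝔮)[P]` presented as a quotient of a polynomial ring — the form in which chart computations are
  done), `Spec T` regular at the primes `⊊ 𝔳`, generators of `𝔳^{b+1}` and the two chart facts;
* ★★★ `hasResolution_of_isolated_fixedPoints_of_two_step_chart` — every singular point of this kind ⇒ `Scheme.HasResolution X`;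
* `exists_ringEquiv_adicCompletion_stalk_of_chart` — the model isomorphism itself (as `Nonempty`, for any Noetherian charted model).

The model is kept GENERIC on purpose: for the sub-algebra presentation `T = κ(𝔮)[χᵈ : d ∈ G] ⊆ κ(𝔮)[x₁,…,xₙ]` the chart-ring
hypotheses (`blowupAlgebra (𝔳^{b+1}) yⱼ` over `↥(Algebra.adjoin …)`) do not elaborate at statement level (instance synthesis
`Algebra ↥T ↥(blowupAlgebra …)` times out — the sub-algebra-of-localization diamond recorded in `…MonomialAlgebraCompletion`);
per-class chart computations should present the model lightly (a quotient of a polynomial ring by its toric ideal, with the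
monomial chart `χ`), for which every hypothesis here is a plain statement; the hypotheses `hres`, `hχ*`, `hgen`, `hdim` for the
sub-algebra presentation are `…MonomialAlgebraCompletion.exists_chart`, `…MonomialAlgebraVertex.exists_sub_algebraMap_mem_maximalIdeal`
and `…MonomialAlgebraDimension.ringKrullDim_localization_vertex_eq_rank` (used that way INSIDE proofs, cf. p840843).

This is the two-step counterpart of `…FixedPointResolutionModel.hasResolution_of_isolated_fixedPoints_of_model` (p840932, ONE
blow-up). Honest label: assembly toward ONE leaf stub (no stub, crux or summit closed). No definitions, no named facts, no sorry.
[cite: Kato1994, Thm. (3.2)] [cite: Kollar2007, §2.2] [cite: Matsumura1987, Thm. 8.11; Thm. 8.14; Thm. 23.7]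
-/

noncomputable section

-- single-problem summit: the doubled namespace component is forced
set_option linter.dupNamespace false

open CategoryTheory AlgebraicGeometry TopologicalSpace IsLocalRing
open Literature.RingTheory.MvPowerSeries Literature.RingTheory.MvPowerSeries.monoidPowerSeries
open Literature.AlgebraicGeometry.Resolution

namespace Summit.ResolutionOfSingularities.ResolutionOfSingularities.Theorems.FRationalResolution.FixedPointTwoStepModel

variable {k' : Type} [Field k'] {A : Type} [DecidableEq A] [AddCommGroup A] {S : Type}
  [CommRing S] [Algebra k' S] (𝒮 : A → Submodule k' S) [GradedAlgebra 𝒮]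

/-! ## §1 The model isomorphism at a fixed point -/

/-- ★★ **`(T_𝔳)^ ≅ (𝒪_{Spec S₀, 𝔮})^` for any model charted by the weight kernel.** Fixed-point data (`S` of finite type
over a field, torsion grading, `𝔔 ⊇ S_a` for `a ≠ 0`, homogeneous `xᵢ ∈ 𝔔 ∩ S_{aᵢ}` generating `𝔪_{S_𝔔}`, `n = dim S_𝔔`,
`m ∈ P ↔ Σ mᵢ • aᵢ = 0`) and a model: `T` Noetherian over `κ(𝔮)` (`𝔮 = 𝔔 ∩ S₀`), `𝔳` maximal and `κ(𝔮)`-rational, a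
multiplicative chart `χ : P → T` with `χ(P ∖ 0) ⊆ 𝔳` generating `𝔳`, `dim T_𝔳 = n`. Then the complete local rings agree.
[cite: Kato1994, Thm. (3.2)] [cite: Matsumura1987, Thm. 8.11] -/
theorem exists_ringEquiv_adicCompletion_stalk_of_chart [Algebra.FiniteType k' S]
    (hA : AddMonoid.IsTorsion A) (𝔔 : Ideal S) [𝔔.IsPrime]
    (hfix : ∀ a : A, a ≠ 0 → ∀ s ∈ 𝒮 a, s ∈ 𝔔)
    {n : ℕ} (x : Fin n → S) (a : Fin n → A) (hxa : ∀ i, x i ∈ 𝔔 ∧ x i ∈ 𝒮 (a i))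
    (hspan : Ideal.span (algebraMap S (Localization.AtPrime 𝔔) '' Set.range x) =
      maximalIdeal (Localization.AtPrime 𝔔))
    (hn : (n : WithBot ℕ∞) = ringKrullDim (Localization.AtPrime 𝔔))
    (P : AddSubmonoid (Fin n →₀ ℕ)) (hP : ∀ m, m ∈ P ↔ Finsupp.weight a m = 0)
    {T : Type} [CommRing T] [Algebra (ResidueField (Localization.AtPrime (𝔔.comap (algebraMap (𝒮 0) S)))) T]
    [IsNoetherianRing T] (𝔳 : Ideal T) [𝔳.IsMaximal]
    (hres : ∀ z : Localization.AtPrime 𝔳, ∃ c : ResidueField (Localization.AtPrime (𝔔.comap (algebraMap (𝒮 0) S))),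
      z - algebraMap _ (Localization.AtPrime 𝔳) c ∈ maximalIdeal (Localization.AtPrime 𝔳))
    (χ : (Fin n →₀ ℕ) → T) (hχ0 : χ 0 = 1) (hχadd : ∀ p ∈ P, ∀ q ∈ P, χ (p + q) = χ p * χ q)
    (hχm : ∀ p ∈ P, p ≠ 0 → χ p ∈ 𝔳) (hgen : 𝔳 ≤ Ideal.span (χ '' {p | p ∈ P ∧ p ≠ 0}))
    (hdim : ringKrullDim (Localization.AtPrime 𝔳) = n) :
    Nonempty (AdicCompletion (maximalIdeal (Localization.AtPrime 𝔳)) (Localization.AtPrime 𝔳) ≃+*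
      AdicCompletion (maximalIdeal ((Spec (.of (𝒮 0))).presheaf.stalk
        (⟨𝔔.comap (algebraMap (𝒮 0) S), inferInstance⟩ : Spec (.of (𝒮 0)))))
        ((Spec (.of (𝒮 0))).presheaf.stalk (⟨𝔔.comap (algebraMap (𝒮 0) S), inferInstance⟩ : Spec (.of (𝒮 0))))) := by
  set 𝔮 := 𝔔.comap (algebraMap (𝒮 0) S) with h𝔮
  -- `κ(𝔮)⟦P⟧ ≅ ((S₀)_𝔮)^`
  obtain ⟨hPfg, hrank, -, -⟩ := FixedPointCompletionChart.chartData_of_parameters 𝒮 hA 𝔔 hfix x a hxa hspan hn P hP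
    (Localization.AtPrime 𝔮)
  obtain ⟨-, e₁, -, -⟩ := FixedPointCompletionChart.exists_ringEquiv_monoidPowerSeries_adicCompletion_of_parameters
    𝒮 hA 𝔔 hfix x a hxa hspan hn P hP (Localization.AtPrime 𝔮)
  -- `κ(𝔮)⟦P⟧ ≅ (T_𝔳)^`
  obtain ⟨e₀, -⟩ := MonomialAlgebraCompletion.exists_ringEquiv_monoidPowerSeries_adicCompletion_of_chart
    (ResidueField (Localization.AtPrime 𝔮)) 𝔳 hres P hPfg χ hχ0 hχadd hχm hgen (by rw [hdim, hrank])
  -- `((S₀)_𝔮)^ ≅ (𝒪_{Spec S₀, 𝔮})^`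
  obtain ⟨ê, -⟩ := CompletedBaseChangeFibreCompletion.exists_ringEquiv_adicCompletion_of_ringEquiv
    (Spec.stalkIso (.of (𝒮 0)) (⟨𝔮, inferInstance⟩ : Spec (.of (𝒮 0)))).commRingCatIsoToRingEquiv.symm
  exact ⟨e₀.symm.trans (e₁.trans ê)⟩

/-! ## §2 `hloc` and `HasResolution` from fixed-point data and a charted model -/

/-- ★★★ **THE NAIVE TWO-STEP RECIPE AT A FIXED POINT, ANY CHARTED MODEL.** `X` integral, locally of finite type over a field
`k`, finitely many singular points; `φ : Spec S₀ → X` étale (`S` of finite type over a field `k'`, graded by a torsion group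
`A`), `𝔔` a `D(A)`-fixed prime with homogeneous regular parameters `x, a` (`n = dim S_𝔔`) mapping to a SINGULAR point, `P` the
weight kernel; a model `T` of finite type over `κ(𝔮)` with a `κ(𝔮)`-rational maximal ideal `𝔳` of height `n` charted by `P`,
`Spec T` regular at the primes `⊊ 𝔳`, generators `yⱼ` of `𝔳^{b+1}` such that the chart rings `T[𝔳^{b+1}/yⱼ]` have finitely
many non-regular primes over `𝔳`, at each of which the point blow-up is regular ⇒ `hloc` at `φ 𝔮`.
[cite: Kato1994, Thm. (3.2)] [cite: Kollar2007, §2.2] [cite: Matsumura1987, Thm. 8.11; Thm. 8.14; Thm. 23.7] -/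
theorem hloc_of_fixedPoint_two_step_chart (k : Type) [Field k] (X : Scheme.{0}) [IsIntegral X]
    (f : X ⟶ Spec (.of k)) [LocallyOfFiniteType f] (hfin : (Scheme.regularLocus X)ᶜ.Finite)
    [Algebra.FiniteType k' S] (hA : AddMonoid.IsTorsion A)
    (φ : Spec (.of (𝒮 0)) ⟶ X) [Etale φ] (𝔔 : Ideal S) [𝔔.IsPrime]
    (hfix : ∀ a : A, a ≠ 0 → ∀ s ∈ 𝒮 a, s ∈ 𝔔)
    (hx : φ ⟨𝔔.comap (algebraMap (𝒮 0) S), inferInstance⟩ ∉ Scheme.regularLocus X)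
    {n : ℕ} (x : Fin n → S) (a : Fin n → A) (hxa : ∀ i, x i ∈ 𝔔 ∧ x i ∈ 𝒮 (a i))
    (hspan : Ideal.span (algebraMap S (Localization.AtPrime 𝔔) '' Set.range x) =
      maximalIdeal (Localization.AtPrime 𝔔))
    (hn : (n : WithBot ℕ∞) = ringKrullDim (Localization.AtPrime 𝔔))
    (P : AddSubmonoid (Fin n →₀ ℕ)) (hP : ∀ m, m ∈ P ↔ Finsupp.weight a m = 0)
    (T : Type) [CommRing T] [Algebra (ResidueField (Localization.AtPrime (𝔔.comap (algebraMap (𝒮 0) S)))) T]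
    [Algebra.FiniteType (ResidueField (Localization.AtPrime (𝔔.comap (algebraMap (𝒮 0) S)))) T]
    (𝔳 : Ideal T) [𝔳.IsMaximal]
    (hres : ∀ z : Localization.AtPrime 𝔳, ∃ c : ResidueField (Localization.AtPrime (𝔔.comap (algebraMap (𝒮 0) S))),
      z - algebraMap _ (Localization.AtPrime 𝔳) c ∈ maximalIdeal (Localization.AtPrime 𝔳))
    (χ : (Fin n →₀ ℕ) → T) (hχ0 : χ 0 = 1) (hχadd : ∀ p ∈ P, ∀ q ∈ P, χ (p + q) = χ p * χ q)
    (hχm : ∀ p ∈ P, p ≠ 0 → χ p ∈ 𝔳) (hgen : 𝔳 ≤ Ideal.span (χ '' {p | p ∈ P ∧ p ≠ 0}))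
    (hdim : ringKrullDim (Localization.AtPrime 𝔳) = n)
    (hoff : ∀ t : Spec (.of T), t.asIdeal ≤ 𝔳 → t.asIdeal ≠ 𝔳 → t ∈ Scheme.regularLocus (Spec (.of T)))
    (b : ℕ) {m : ℕ} (y : Fin m → T) (hyv : 𝔳 ^ (b + 1) = Ideal.span (Set.range y))
    (hfinm : ∀ j : Fin m, {𝔫 : PrimeSpectrum (blowupAlgebra (𝔳 ^ (b + 1)) (y j)) |
      𝔳.map (algebraMap T (blowupAlgebra (𝔳 ^ (b + 1)) (y j))) ≤ 𝔫.asIdeal ∧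
        ¬ IsRegularLocalRing (Localization.AtPrime 𝔫.asIdeal)}.Finite)
    (hmodel : ∀ (j : Fin m) (𝔫 : PrimeSpectrum (blowupAlgebra (𝔳 ^ (b + 1)) (y j))),
      𝔳.map (algebraMap T (blowupAlgebra (𝔳 ^ (b + 1)) (y j))) ≤ 𝔫.asIdeal →
      ¬ IsRegularLocalRing (Localization.AtPrime 𝔫.asIdeal) →
      Scheme.IsRegular (affineBlowup (R := Localization.AtPrime 𝔫.asIdeal)
        (maximalIdeal (Localization.AtPrime 𝔫.asIdeal)))) :
    ∃ (W : X.Opens), φ ⟨𝔔.comap (algebraMap (𝒮 0) S), inferInstance⟩ ∈ W ∧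
      (∀ t : X, t ∉ Scheme.regularLocus X → t ∈ W → t = φ ⟨𝔔.comap (algebraMap (𝒮 0) S), inferInstance⟩) ∧
      ∃ (Z : Scheme.{0}) (ρ : Z ⟶ W), IsProper ρ ∧ Scheme.IsRegular Z ∧
        IsIso (ρ ∣_ (W.ι ⁻¹ᵁ ⟨Scheme.regularLocus X, isOpen_regularLocus_of_locallyOfFiniteType_field f⟩)) ∧
        Dense ((ρ ⁻¹ᵁ (W.ι ⁻¹ᵁ ⟨Scheme.regularLocus X,
          isOpen_regularLocus_of_locallyOfFiniteType_field f⟩) : Z.Opens) : Set Z) := by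
  haveI : IsNoetherianRing T :=
    Algebra.FiniteType.isNoetherianRing (ResidueField (Localization.AtPrime (𝔔.comap (algebraMap (𝒮 0) S)))) T
  obtain ⟨e⟩ := exists_ringEquiv_adicCompletion_stalk_of_chart 𝒮 hA 𝔔 hfix x a hxa hspan hn P hP 𝔳 hres χ hχ0 hχadd
    hχm hgen hdim
  exact EtaleChartTwoStepModelScheme.hloc_of_model_charts_etale_nhd k X f hfin φ _ hx b
    (ResidueField (Localization.AtPrime (𝔔.comap (algebraMap (𝒮 0) S)))) T 𝔳 hoff e y hyv hfinm hmodel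

/-- ★★★ **RESOLUTION OF VARIETIES WHOSE SINGULAR POINTS ARE ISOLATED FIXED POINTS OF QUOTIENT CHARTS WITH A CHARTED MODEL
RESOLVED BY THE NAIVE TWO-STEP RECIPE.** Every singular point of `X` (integral, locally of finite type over a field, finitely
many singular points) carries the data of `hloc_of_fixedPoint_two_step_chart` ⇒ `X` has a resolution of singularities.
[cite: Kato1994, Thm. (3.2)] [cite: Kollar2007, §2.2] [cite: Matsumura1987, Thm. 8.11; Thm. 8.14; Thm. 23.7] -/
theorem hasResolution_of_isolated_fixedPoints_of_two_step_chart (k : Type) [Field k] (X : Scheme.{0}) [IsIntegral X]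
    (f : X ⟶ Spec (.of k)) [LocallyOfFiniteType f] (hfin : (Scheme.regularLocus X)ᶜ.Finite)
    (hchart : ∀ t : X, t ∉ Scheme.regularLocus X →
      ∃ (k' : Type) (_ : Field k') (A : Type) (_ : DecidableEq A) (_ : AddCommGroup A) (_ : AddMonoid.IsTorsion A)
        (S : Type) (_ : CommRing S) (_ : Algebra k' S) (𝒮 : A → Submodule k' S) (_ : GradedAlgebra 𝒮)
        (_ : Algebra.FiniteType k' S) (φ : Spec (.of (𝒮 0)) ⟶ X) (_ : Etale φ)
        (𝔔 : Ideal S) (_ : 𝔔.IsPrime) (_ : ∀ a : A, a ≠ 0 → ∀ s ∈ 𝒮 a, s ∈ 𝔔)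
        (n : ℕ) (x : Fin n → S) (a : Fin n → A) (P : AddSubmonoid (Fin n →₀ ℕ))
        (_ : ∀ i, x i ∈ 𝔔 ∧ x i ∈ 𝒮 (a i))
        (_ : Ideal.span (algebraMap S (Localization.AtPrime 𝔔) '' Set.range x) = maximalIdeal (Localization.AtPrime 𝔔))
        (_ : (n : WithBot ℕ∞) = ringKrullDim (Localization.AtPrime 𝔔))
        (_ : ∀ m, m ∈ P ↔ Finsupp.weight a m = 0)
        (T : Type) (_ : CommRing T) (_ : Algebra (ResidueField (Localization.AtPrime (𝔔.comap (algebraMap (𝒮 0) S)))) T)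
        (_ : Algebra.FiniteType (ResidueField (Localization.AtPrime (𝔔.comap (algebraMap (𝒮 0) S)))) T)
        (𝔳 : Ideal T) (_ : 𝔳.IsMaximal)
        (_ : ∀ z : Localization.AtPrime 𝔳, ∃ c : ResidueField (Localization.AtPrime (𝔔.comap (algebraMap (𝒮 0) S))),
          z - algebraMap _ (Localization.AtPrime 𝔳) c ∈ maximalIdeal (Localization.AtPrime 𝔳))
        (χ : (Fin n →₀ ℕ) → T) (_ : χ 0 = 1) (_ : ∀ p ∈ P, ∀ q ∈ P, χ (p + q) = χ p * χ q)
        (_ : ∀ p ∈ P, p ≠ 0 → χ p ∈ 𝔳) (_ : 𝔳 ≤ Ideal.span (χ '' {p | p ∈ P ∧ p ≠ 0}))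
        (_ : ringKrullDim (Localization.AtPrime 𝔳) = n)
        (_ : ∀ t : Spec (.of T), t.asIdeal ≤ 𝔳 → t.asIdeal ≠ 𝔳 → t ∈ Scheme.regularLocus (Spec (.of T)))
        (b m : ℕ) (y : Fin m → T) (_ : 𝔳 ^ (b + 1) = Ideal.span (Set.range y))
        (_ : ∀ j : Fin m, {𝔫 : PrimeSpectrum (blowupAlgebra (𝔳 ^ (b + 1)) (y j)) |
          𝔳.map (algebraMap T (blowupAlgebra (𝔳 ^ (b + 1)) (y j))) ≤ 𝔫.asIdeal ∧
            ¬ IsRegularLocalRing (Localization.AtPrime 𝔫.asIdeal)}.Finite),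
        φ ⟨𝔔.comap (algebraMap (𝒮 0) S), inferInstance⟩ = t ∧
        ∀ (j : Fin m) (𝔫 : PrimeSpectrum (blowupAlgebra (𝔳 ^ (b + 1)) (y j))),
          𝔳.map (algebraMap T (blowupAlgebra (𝔳 ^ (b + 1)) (y j))) ≤ 𝔫.asIdeal →
          ¬ IsRegularLocalRing (Localization.AtPrime 𝔫.asIdeal) →
          Scheme.IsRegular (affineBlowup (R := Localization.AtPrime 𝔫.asIdeal)
            (maximalIdeal (Localization.AtPrime 𝔫.asIdeal)))) :
    Scheme.HasResolution X := by
  refine IsolatedGlue.hasResolution_of_finite_singularLocus_of_local k X f hfin fun t ht => ?_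
  obtain ⟨k', _, A, _, _, hA, S, _, _, 𝒮, _, _, φ, _, 𝔔, _, hfix, n, x, a, P, hxa, hspan, hn, hP, T, _, _, _, 𝔳, _,
    hres, χ, hχ0, hχadd, hχm, hgen, hdim, hoff, b, m, y, hyv, hfinm, hφt, hmodel⟩ := hchart t ht
  subst hφt
  exact hloc_of_fixedPoint_two_step_chart 𝒮 k X f hfin hA φ 𝔔 hfix ht x a hxa hspan hn P hP T 𝔳 hres χ hχ0 hχadd hχm
    hgen hdim hoff b y hyv hfinm hmodel

end Summit.ResolutionOfSingularities.ResolutionOfSingularities.Theorems.FRationalResolution.FixedPointTwoStepModel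

end
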